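import Mathlib
import HarnessLib
import Literature.LinearAlgebra.Matrix.SpecialUnitaryGroupConjugacyClasses

/-!
# In `SU(3)` the trace decides conjugacy: `charpoly U = X³ − t X² + t̄ X − 1`, so `U ∼ V ⇔ tr U = tr V`, and every class function is a function of the trace

HONEST FRAMING: exact (Metropolis-corrected) sampling algorithms for lattice gauge theory;
figures of merit are autocorrelation/cost numbers at stated couplings and volumes; no
continuum-physics claim.

Venture `LatticeQCDFlow` (cell pub-lqcd), sub-topic `Scoring`; FANOUT row 21 (`su3-base`: the 4D
`SU(3)` baselines).  NEW WORK of the cell (placement rule), elementary, over the Literature file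
`LinearAlgebra/Matrix/SpecialUnitaryGroupConjugacyClasses` (`isConj_iff_charpoly_eq_su`: conjugacy
classes of `SU(n)` are the fibres of the characteristic polynomial, Bröcker–tom Dieck IV (2.5)–(2.6));
no definition is introduced; nothing is cited as a fact; no number of ours.

Why row 21 cares: every single-plaquette quantity the `SU(3)` baseline touches — the Wilson weight
`e^{(β/3) Re tr U_p}`, the heat-bath and over-relaxation acceptance data, the plaquette, the doubly
wound plaquette `Re tr U_p²`, any character — is a CLASS FUNCTION of `U_p ∈ SU(3)`.  For `SU(3)` (and
unlike `SU(N)`, `N ≥ 4`) a class function is a function of ONE complex number, the trace: the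
characteristic polynomial of `U ∈ SU(3)` is `X³ − t X² + t̄ X − 1` with `t = tr U` (the linear
coefficient, the trace of the adjugate, is `conj t` because `adj U = U†`), so the trace fixes the
spectrum and hence the conjugacy class.

## What is proved

* §1 (any commutative ring) **`charpoly_fin_three_adjugate`**:
  `charpoly M = X³ − C(tr M) X² + C(tr adj M) X − C(det M)` for `3 × 3` matrices (Mathlib has the
  `2 × 2` case `Matrix.charpoly_fin_two`; the tree's `Matrix.charpoly_fin_three` in
  `Literature/NumberTheory/GaloisRepresentations/ResidualRepOfTraceCongruence` spells the linear
  coefficient out as the three principal minors — here it is packaged as `tr adj M`, the form the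
  `SU(3)` step needs).
* §2 (`SU(3)`) **`su3_charpoly`**: `charpoly U = X³ − C t X² + C t̄ X − 1`, `t = tr U`;
  **`su3_isConj_iff_trace_eq`**: `U, V ∈ SU(3)` are conjugate in `SU(3)` iff `tr U = tr V`;
  `su3_charpoly_eq_iff_trace_eq`; **`su3_isConj_inv_iff_im_trace_eq_zero`**: `U` is conjugate to
  `U⁻¹ = U†` (equivalently, to its complex conjugate) iff `tr U` is REAL.
* §3 (class functions) **`su3_classFunction_eq_of_trace_eq`**: a conjugation-invariant `f` on `SU(3)`
  takes equal values on elements with equal trace; **`su3_exists_factor_through_trace`**: such an `f`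
  factors as `g ∘ tr` for some `g : ℂ → Y`; conversely `su3_trace_comp_isClassFunction` (any
  `g ∘ tr` is a class function).

NOT CLAIMED: the description of the IMAGE of the trace (the closed deltoid region) or the induced
measure on it (the `SU(3)` Weyl density in the trace variable); anything for `N ≠ 3` (false for
`N ≥ 4`: `diag(1,1,−1,−1)` and `diag(i,−i,1,1)`… have equal traces `0` but different spectra).
-/

namespace Summit.Ventures.LatticeQCDFlow.Scoring

open Matrix Polynomial
open Literature.LinearAlgebra.Matrix

/-! ## §1 The characteristic polynomial of a `3 × 3` matrix -/

section AnyRing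

variable {R : Type*} [CommRing R]

/-- **`charpoly M = X³ − C(tr M)·X² + C(tr adj M)·X − C(det M)`** for a `3 × 3` matrix over a
commutative ring (the linear coefficient is the trace of the adjugate = the sum of the principal
`2 × 2` minors). -/
theorem charpoly_fin_three_adjugate (M : Matrix (Fin 3) (Fin 3) R) :
    M.charpoly = X ^ 3 - C M.trace * X ^ 2 + C (adjugate M).trace * X - C M.det := by
  have hadj : (adjugate M).trace = M 1 1 * M 2 2 - M 1 2 * M 2 1 + (M 0 0 * M 2 2 - M 0 2 * M 2 0)
      + (M 0 0 * M 1 1 - M 0 1 * M 1 0) := by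
    simp [adjugate_fin_three, trace_fin_three]
  rw [Matrix.charpoly, Matrix.det_fin_three, hadj]
  simp only [Matrix.charmatrix_apply, Matrix.diagonal_apply_eq, Matrix.diagonal_apply_ne,
    trace_fin_three, det_fin_three, ne_eq, Fin.isValue, Fin.reduceEq, not_false_eq_true, zero_sub,
    map_add, map_sub, map_mul]
  ring

end AnyRing

/-! ## §2 `SU(3)`: the characteristic polynomial, hence the conjugacy class, is fixed by the trace -/

section SpecialUnitaryThree

/-- **`charpoly U = X³ − C t·X² + C t̄·X − 1`** for `U ∈ SU(3)`, `t = tr U`: on `SU(3)` the adjugate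
is `det(U)·U⁻¹ = U†`, whose trace is `conj (tr U)`, and `det U = 1`. -/
theorem su3_charpoly (U : Matrix.specialUnitaryGroup (Fin 3) ℂ) :
    (U : Matrix (Fin 3) (Fin 3) ℂ).charpoly =
      X ^ 3 - C (U : Matrix (Fin 3) (Fin 3) ℂ).trace * X ^ 2
        + C ((starRingEnd ℂ) (U : Matrix (Fin 3) (Fin 3) ℂ).trace) * X - 1 := by
  have hU := U.2
  have hunit : (U : Matrix (Fin 3) (Fin 3) ℂ) ∈ Matrix.unitaryGroup (Fin 3) ℂ :=
    (Matrix.mem_specialUnitaryGroup_iff.mp hU).1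
  have hdet : (U : Matrix (Fin 3) (Fin 3) ℂ).det = 1 := (Matrix.mem_specialUnitaryGroup_iff.mp hU).2
  -- `adj U = U†`
  have hadj : adjugate (U : Matrix (Fin 3) (Fin 3) ℂ) = star (U : Matrix (Fin 3) (Fin 3) ℂ) := by
    have h1 : (U : Matrix (Fin 3) (Fin 3) ℂ) * adjugate (U : Matrix (Fin 3) (Fin 3) ℂ) = 1 := by
      rw [mul_adjugate, hdet, one_smul]
    have h2 : star (U : Matrix (Fin 3) (Fin 3) ℂ) * (U : Matrix (Fin 3) (Fin 3) ℂ) = 1 :=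
      Unitary.star_mul_self_of_mem hunit
    calc adjugate (U : Matrix (Fin 3) (Fin 3) ℂ)
        = (star (U : Matrix (Fin 3) (Fin 3) ℂ) * (U : Matrix (Fin 3) (Fin 3) ℂ)) *
            adjugate (U : Matrix (Fin 3) (Fin 3) ℂ) := by rw [h2, Matrix.one_mul]
      _ = star (U : Matrix (Fin 3) (Fin 3) ℂ) *
            ((U : Matrix (Fin 3) (Fin 3) ℂ) * adjugate (U : Matrix (Fin 3) (Fin 3) ℂ)) := by
          rw [Matrix.mul_assoc]
      _ = star (U : Matrix (Fin 3) (Fin 3) ℂ) := by rw [h1, Matrix.mul_one]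
  have htr : (adjugate (U : Matrix (Fin 3) (Fin 3) ℂ)).trace =
      (starRingEnd ℂ) (U : Matrix (Fin 3) (Fin 3) ℂ).trace := by
    rw [hadj, star_eq_conjTranspose, trace_conjTranspose, Complex.star_def]
  rw [charpoly_fin_three_adjugate, htr, hdet, map_one]

/-- Equal traces give equal characteristic polynomials on `SU(3)` (and conversely). -/
theorem su3_charpoly_eq_iff_trace_eq (U V : Matrix.specialUnitaryGroup (Fin 3) ℂ) :
    (U : Matrix (Fin 3) (Fin 3) ℂ).charpoly = (V : Matrix (Fin 3) (Fin 3) ℂ).charpoly ↔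
      (U : Matrix (Fin 3) (Fin 3) ℂ).trace = (V : Matrix (Fin 3) (Fin 3) ℂ).trace := by
  constructor
  · intro h
    have h2 := congrArg (fun p : ℂ[X] => p.coeff 2) h
    simp only [su3_charpoly, coeff_sub, coeff_add, coeff_X_pow, coeff_C_mul, coeff_X, coeff_one]
      at h2
    norm_num at h2
    exact h2
  · intro h
    rw [su3_charpoly, su3_charpoly, h]

/-- **In `SU(3)` the trace decides conjugacy**: `U` and `V` are conjugate in `SU(3)` iff
`tr U = tr V`. -/
theorem su3_isConj_iff_trace_eq (U V : Matrix.specialUnitaryGroup (Fin 3) ℂ) :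
    IsConj U V ↔ (U : Matrix (Fin 3) (Fin 3) ℂ).trace = (V : Matrix (Fin 3) (Fin 3) ℂ).trace := by
  rw [isConj_iff_charpoly_eq_su, su3_charpoly_eq_iff_trace_eq]

/-- **`U ∼ U⁻¹` in `SU(3)` iff `tr U` is real**: the inverse `U⁻¹ = U†` has trace `conj (tr U)`, so by
`su3_isConj_iff_trace_eq` an `SU(3)` element is conjugate to its inverse (equivalently to its complex
conjugate, which has the same trace `conj (tr U)`) exactly when `Im tr U = 0`. -/
theorem su3_isConj_inv_iff_im_trace_eq_zero (U : Matrix.specialUnitaryGroup (Fin 3) ℂ) :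
    IsConj U U⁻¹ ↔ ((U : Matrix (Fin 3) (Fin 3) ℂ).trace).im = 0 := by
  rw [su3_isConj_iff_trace_eq]
  have hinv : ((U⁻¹ : Matrix.specialUnitaryGroup (Fin 3) ℂ) : Matrix (Fin 3) (Fin 3) ℂ) =
      star (U : Matrix (Fin 3) (Fin 3) ℂ) := rfl
  rw [hinv, star_eq_conjTranspose, trace_conjTranspose, Complex.star_def, eq_comm,
    Complex.conj_eq_iff_im]

end SpecialUnitaryThree

/-! ## §3 Class functions on `SU(3)` are functions of the trace -/

section ClassFunctions

variable {Y : Type*}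

/-- **A class function on `SU(3)` takes equal values on elements with equal trace.** -/
theorem su3_classFunction_eq_of_trace_eq {f : Matrix.specialUnitaryGroup (Fin 3) ℂ → Y}
    (hf : ∀ c U, f (c * U * c⁻¹) = f U) {U V : Matrix.specialUnitaryGroup (Fin 3) ℂ}
    (h : (U : Matrix (Fin 3) (Fin 3) ℂ).trace = (V : Matrix (Fin 3) (Fin 3) ℂ).trace) :
    f U = f V := by
  obtain ⟨c, hc⟩ := isConj_iff.mp ((su3_isConj_iff_trace_eq U V).mpr h)
  rw [← hc, hf]

/-- **Every class function on `SU(3)` factors through the trace**: `f = g ∘ tr` for some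
`g : ℂ → Y` (no continuity statement is made about `g`). -/
theorem su3_exists_factor_through_trace [Nonempty Y] {f : Matrix.specialUnitaryGroup (Fin 3) ℂ → Y}
    (hf : ∀ c U, f (c * U * c⁻¹) = f U) :
    ∃ g : ℂ → Y, ∀ U, f U = g ((U : Matrix (Fin 3) (Fin 3) ℂ).trace) := by
  classical
  refine ⟨fun t => if h : ∃ U : Matrix.specialUnitaryGroup (Fin 3) ℂ,
      (U : Matrix (Fin 3) (Fin 3) ℂ).trace = t then f h.choose else Classical.arbitrary Y, fun U => ?_⟩
  have hex : ∃ V : Matrix.specialUnitaryGroup (Fin 3) ℂ,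
      (V : Matrix (Fin 3) (Fin 3) ℂ).trace = (U : Matrix (Fin 3) (Fin 3) ℂ).trace := ⟨U, rfl⟩
  simp only [hex, dif_pos]
  exact su3_classFunction_eq_of_trace_eq hf hex.choose_spec.symm

/-- Conversely, any function of the trace is a class function on `SU(3)` (the trace is cyclic). -/
theorem su3_trace_comp_isClassFunction (g : ℂ → Y) (c U : Matrix.specialUnitaryGroup (Fin 3) ℂ) :
    g (((c * U * c⁻¹ : Matrix.specialUnitaryGroup (Fin 3) ℂ) : Matrix (Fin 3) (Fin 3) ℂ).trace) =
      g ((U : Matrix (Fin 3) (Fin 3) ℂ).trace) := by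
  congr 1
  change ((c : Matrix (Fin 3) (Fin 3) ℂ) * (U : Matrix (Fin 3) (Fin 3) ℂ) *
      star (c : Matrix (Fin 3) (Fin 3) ℂ)).trace = _
  rw [Matrix.trace_mul_cycle, Unitary.star_mul_self_of_mem (Matrix.mem_specialUnitaryGroup_iff.mp c.2).1,
    Matrix.one_mul]

end ClassFunctions

end Summit.Ventures.LatticeQCDFlow.Scoring
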